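import Summits.AtomisticToContinuum.Crystallization.Theorems.FrustratedLawDichotomyStrainedPatchHomEntryFitHcpCentredSqSound

/-!
# The squared centred pair test in CORE FORM: `fitOKHDCRS_core` (27623 `(H) HomFloor (1/625)`, hcp half; lens-5 g90, port item PT-1 of NODE 90 «ParamTransfer»)

decomp-a2c lens-5 g90 (crux `AperiodicFrustratedLawGap`, stmt-AtomisticToContinuum-27623).  ★ `fitOKHDCRS_core` = `…CentredSqSound.fitOKHDCRS_sound`
VERBATIM, STOPPED BEFORE ITS LAST CALL: the window hypothesis `hU : ‖U - 1‖ ≤ 1/4` is DROPPED (the original uses it only inside the final application of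
`…HomEntryFitHcpRotReal.goodAtScale_of_fitBounds_hcp_eta_minR`), and the conclusion is the window clause `‖ξ‖ ≤ 1/2` read off the box together with the ELEVEN
real core hypotheses of that theorem at `η' = 4999/100000`, `dlo = (dEnclH c w).lo/SC`, `dhi = (dEnclH c w).hi/SC`, `d2lo = d2S/SC` — i.e. literally the definiens of
`…HomParamTransfer.HcpFitCore U ξ R (4999/100000) ((dEnclH c w).lo/SC) ((dEnclH c w).hi/SC) d2lo` (NODE 90), spelled out so that this file does not depend on it
(once both are in the tree the bridge is `exact (fitOKHDCRS_core h U ξ hsa hbox hξb).2`, by `δ`-unfolding).  This is the certificate format consumed by the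
dilation-cone and ξ-collar transfer lemmas of NODE 90 (`HcpFitCore.dilate`, `hcpLeafGoal_of_cone`, …): a box certified by the kit of record `fitOKHDCRS` serves as
the BASE of a cone leaf without any window condition on the base.

Def-free; 0 sorry; standard axioms; no instances / notation / `#eval`; proof text = the tree proof with three mechanical edits (statement, dropped binder, final
`refine`).  `--supports stmt-AtomisticToContinuum-27623 --as helper`.
-/

noncomputable section

namespace Summit.AtomisticToContinuum.Crystallization.Theorems.FrustratedLawDichotomyStrainedPatchHomEntryFitHcpCentred

open scoped BigOperators RealInnerProductSpace Matrix
open Summit.AtomisticToContinuum.Crystallization.Theorems.FrustratedLawDichotomyStrainedPatchHomOrthogonal (exists_linearIsometry_of_orthogonal)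
open Literature.Analysis.ValidatedNumerics.Numerics
open Literature.Geometry.DiscreteGeometry (hcpKissingPattern)
open Literature.Geometry.DiscreteGeometry.ShellCensus (hcpTuple hcpTuple_injective)
open Summit.AtomisticToContinuum.Crystallization.Theorems.ChargedEnergyGapNegative (E3)
open Summit.AtomisticToContinuum.Crystallization.Theorems.FrustratedLawDichotomySchurCut (effPot w₄₅ ω₄)
open Summit.AtomisticToContinuum.Crystallization.Theorems.FrustratedLawDichotomyMotifLemmas (GoodAtScale)
open Summit.AtomisticToContinuum.Crystallization.Theorems.FrustratedLawDichotomyAveragingRuleTightFree (TightNearCap BadNearCap)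
open Summit.AtomisticToContinuum.Crystallization.Theorems.FrustratedLawDichotomyExemptAbsorption (ExemptNear)
open Summit.AtomisticToContinuum.Crystallization.Theorems.FrustratedLawDichotomyStrainedPatchHomSplit
open Summit.AtomisticToContinuum.Crystallization.Theorems.FrustratedLawDichotomyStrainedPatchHomGram (norm_sq_latPt_eq_sum_gram norm_sq_latPt_add_eq_sum_gram)
open Summit.AtomisticToContinuum.Crystallization.Theorems.FrustratedLawDichotomyStrainedPatchHomLatticeBox (norm_apply_ge_of_near_one latPt_zero)
open Summit.AtomisticToContinuum.Crystallization.Theorems.FrustratedLawDichotomyStrainedPatchHomLatticeBoxHcp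
  (latPt_eq_apply_one shifted_eq_apply mem_box_of_norm_hexPt_lt mem_box_of_norm_hexPt_add_shift_lt)
open Summit.AtomisticToContinuum.Crystallization.Theorems.FrustratedLawDichotomyStrainedPatchHomPrunesFit (goodAtScale_centre_of_fit_hcpPattern)
open Summit.AtomisticToContinuum.Crystallization.Theorems.FrustratedLawDichotomyAveragingCut (self_mem_ball)
open Summit.AtomisticToContinuum.Crystallization.Theorems.FrustratedLawDichotomyStrainedPatchHomPrunes (locHom_hcp_centre)
open Summit.AtomisticToContinuum.Crystallization.Theorems.FrustratedLawDichotomyStrainedPatchHomPrunedPolar (homFloor_of_prunedBoxSums_selfAdjoint)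
open Summit.AtomisticToContinuum.Crystallization.Theorems.FrustratedLawDichotomyStrainedPatchHomLeafCheckC (iccC iccC_eq)
open Summit.AtomisticToContinuum.Crystallization.Theorems.FrustratedLawDichotomyStrainedPatchHomCertTree (CertTree treeOK)
open Summit.AtomisticToContinuum.Crystallization.Theorems.FrustratedLawDichotomyStrainedPatchHomEntryGram
open Summit.AtomisticToContinuum.Crystallization.Theorems.FrustratedLawDichotomyStrainedPatchHomEntryFitKit (lmin lmin_le_of_mem lmin_mem)
open Summit.AtomisticToContinuum.Crystallization.Theorems.FrustratedLawDichotomyStrainedPatchHomEntryFit (scaleL devFI entryLeafOKF fccHalf_of_entryFitTree lmax le_lmax_of_mem)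
open Summit.AtomisticToContinuum.Crystallization.Theorems.FrustratedLawDichotomyStrainedPatchHomEntryGramHcp
open Summit.AtomisticToContinuum.Crystallization.Theorems.FrustratedLawDichotomyStrainedPatchHomEntryHcpFrame
open Summit.AtomisticToContinuum.Crystallization.Theorems.FrustratedLawDichotomyTwoShellRigidityAssemblyDial (hcpTuple_mem exists_hcpTuple_eq)
open Summit.AtomisticToContinuum.Crystallization.Theorems.FrustratedLawDichotomyStrainedPatchHomLatticeBoxHcp (latPt_eq_apply_one)
open Summit.AtomisticToContinuum.Crystallization.Theorems.FrustratedLawDichotomyStrainedPatchHomEntryFit (scaleL devFI lmax le_lmax_of_mem)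
open Summit.AtomisticToContinuum.Crystallization.Theorems.FrustratedLawDichotomyStrainedPatchHomEntryFitHcpKit
open Summit.AtomisticToContinuum.Crystallization.Theorems.FrustratedLawDichotomyStrainedPatchHomEntryFitHcp
open Summit.AtomisticToContinuum.Crystallization.Theorems.FrustratedLawDichotomyStrainedPatchHomEntrySearch
open Summit.AtomisticToContinuum.Crystallization.Theorems.FrustratedLawDichotomyStrainedPatchHomEntrySign (entryLeafOKD fccHalf_of_entrySearchDom)
open Summit.AtomisticToContinuum.Crystallization.Theorems.FrustratedLawDichotomyStrainedPatchHomEntryFitHcpSharpKit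
open Summit.AtomisticToContinuum.Crystallization.Theorems.FrustratedLawDichotomyStrainedPatchHomEntryFitHcpSharp

open Summit.AtomisticToContinuum.Crystallization.Theorems.FrustratedLawDichotomyStrainedPatchHomEntryFitHcpSharpEta
open Summit.AtomisticToContinuum.Crystallization.Theorems.FrustratedLawDichotomyStrainedPatchHomPrunedPolar (homFloor_of_prunedBoxSums_selfAdjoint)
open Summit.AtomisticToContinuum.Crystallization.Theorems.FrustratedLawDichotomyStrainedPatchHomEntryGram (rootC rootW)
open Summit.AtomisticToContinuum.Crystallization.Theorems.FrustratedLawDichotomyStrainedPatchHomEntryGramHcp (rootCH rootWH)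
open Summit.AtomisticToContinuum.Crystallization.Theorems.FrustratedLawDichotomyStrainedPatchHomEntryTable (muRec muRec_ok)
open Summit.AtomisticToContinuum.Crystallization.Theorems.FrustratedLawDichotomyStrainedPatchHomEntryTableP (entryLeafOK6RBKP)
open Summit.AtomisticToContinuum.Crystallization.Theorems.FrustratedLawDichotomyStrainedPatchHomEntryTreeCert (fccHalf_of_entryTree6RBKP)
open Summit.AtomisticToContinuum.Crystallization.Theorems.FrustratedLawDichotomyStrainedPatchHomEntryFlipHcp (HcpDich hcpHalf_of_entryTreeShuf)
open Summit.AtomisticToContinuum.Crystallization.Theorems.FrustratedLawDichotomyStrainedPatchHomEntrySymBox (symH hbox_symU)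
open Summit.AtomisticToContinuum.Crystallization.Theorems.FrustratedLawDichotomyStrainedPatchHomEntryQuickHcp (entryLeafOKHQ entryLeafOKHQ_imp)
open Summit.AtomisticToContinuum.Crystallization.Theorems.FrustratedLawDichotomyStrainedPatchHomLeafTableCheckHcpV (entryLeafOKHVK_sound)
open Summit.AtomisticToContinuum.Crystallization.Theorems.FrustratedLawDichotomyStrainedPatchHomCurvLeafHCC (entryLeafOKHCCX entryLeafOKHCCX_sound)
open Summit.AtomisticToContinuum.Crystallization.Theorems.FrustratedLawDichotomyStrainedPatchHomEntryLeafHT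
  (HTCert entryLeafOKHT4 entryLeafOKHT4_sound)
open Summit.AtomisticToContinuum.Crystallization.Theorems.FrustratedLawDichotomyStrainedPatchHomEntryFitTolerance (cT090 cT095 wU12X12 wU11X11)

/-- ★ **`fitOKHDCRS` in CORE FORM** (no window hypothesis on `U`; conclusion = `‖ξ‖ ≤ 1/2` ∧ the eleven real core hypotheses of
`goodAtScale_of_fitBounds_hcp_eta_minR`, = the definiens of NODE 90's `HcpFitCore U ξ R (4999/100000) (dEnclH.lo/SC) (dEnclH.hi/SC) d2lo`).
Proof: `…CentredSqSound.fitOKHDCRS_sound` verbatim up to its final call. [folklore chaining · mechanical restatement] -/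
theorem fitOKHDCRS_core {c w : (Fin 3 × Fin 3) ⊕ Fin 3 → ℤ} {q : Fin 4 → ℤ} (h : fitOKHDCRS c w q = true) (U : E3 →L[ℝ] E3) (ξ : E3)
    (hsa : ∀ v v' : E3, ⟪U v, v'⟫ = ⟪v, U v'⟫)
    (hbox : ∀ ab : Fin 3 × Fin 3, |(U (EuclideanSpace.single ab.2 (1 : ℝ))) ab.1 - (c (Sum.inl ab) : ℝ) / SC| ≤ (w (Sum.inl ab) : ℝ) / SC)
    (hξb : ∀ i : Fin 3, |ξ i - (c (Sum.inr i) : ℝ) / SC| ≤ (w (Sum.inr i) : ℝ) / SC) :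
    ‖ξ‖ ≤ 1 / 2 ∧ ∃ (R : E3 →ₗᵢ[ℝ] E3) (d2lo : ℝ),
      0 ≤ (4999 / 100000 : ℝ) ∧ (4999 / 100000 : ℝ) < 1 / 20 ∧ 0 < ((dEnclH c w).lo : ℝ) / SC ∧ ((dEnclH c w).hi : ℝ) / SC ≤ 3 / 2 ∧
      (∀ k, ((dEnclH c w).lo : ℝ) / SC ≤ ‖nbrU U ξ k‖) ∧ (∃ k, ‖nbrU U ξ k‖ ≤ ((dEnclH c w).hi : ℝ) / SC) ∧ (∀ k, d2lo ≤ ‖nbrU U ξ k‖ ^ 2) ∧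
      (∀ k k', (∀ j, ‖nbrU U ξ k'‖ ≤ ‖nbrU U ξ j‖) → ‖nbrU U ξ k - ‖nbrU U ξ k'‖ • R (nbr k)‖ ^ 2 ≤ (4999 / 100000 : ℝ) ^ 2 * d2lo) ∧
      (∀ k, ‖nbrU U ξ k‖ ≤ 13 / 10 * (((dEnclH c w).lo : ℝ) / SC) - 1 / 100) ∧
      (∀ b ∈ (Fintype.piFinset fun _ : Fin 3 => Finset.Icc (-7 : ℤ) 7), b ≠ 0 → (∀ k, hshift k = false → hlab k ≠ b) →
        13 / 10 * (((dEnclH c w).hi : ℝ) / SC) + 1 / 100 ≤ ‖latPt U hexFrame b‖) ∧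
      (∀ b ∈ (Fintype.piFinset fun _ : Fin 3 => Finset.Icc (-7 : ℤ) 7), (∀ k, hshift k = true → hlab k ≠ b) →
        13 / 10 * (((dEnclH c w).hi : ℝ) / SC) + 1 / 100 ≤ ‖latPt U hexFrame b + U (hcpShift + ξ)‖) := by
  simp only [fitOKHDCRS, Bool.and_eq_true, decide_eq_true_eq, List.all_eq_true] at h
  obtain ⟨⟨⟨⟨⟨⟨⟨⟨⟨⟨hsymm, hL0⟩, h0⟩, h01⟩, h32⟩, h130⟩, hxi4⟩, hNq⟩, hpair⟩, hK⟩, hfar⟩ := h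
  obtain ⟨Riso, hRiso⟩ := exists_linearIsometry_of_orthogonal (cayQ q) (cayQ_orthogonal q hNq)
  have hS := SC_pos
  have hne := SC_ne
  set cU : Fin 3 × Fin 3 → ℤ := fun ab => c (Sum.inl ab) with hcU
  set lam : ℝ := (scaleL cU : ℝ) / SC with hlam
  have hlam0 : 0 ≤ lam := div_nonneg (by exact_mod_cast hL0) hS.le
  set V : E3 →L[ℝ] E3 := U - lam • (1 : E3 →L[ℝ] E3) with hVdef
  have hV : ∀ x : E3, U x = lam • x + V x := fun x => by
    have : V x = U x - lam • x := by simp [hVdef]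
    rw [this]; abel
  -- enclosures of the extended Gram data of `U`, of the deviation entries and of the shuffle
  have hE : ∀ ab : Fin 3 × Fin 3, FI.mem ((U (EuclideanSpace.single ab.2 (1 : ℝ))) ab.1) (entU c w ab) := fun ab => mem_entryFI (hbox ab)
  have hE' : ∀ ab : Fin 3 × Fin 3, FI.mem ((V (EuclideanSpace.single ab.2 (1 : ℝ))) ab.1) (devH c w (scaleL cU) ab) :=
    FrustratedLawDichotomyStrainedPatchHomEntryFit.mem_devFI U (scaleL cU) hbox
  have hX : ∀ i, FI.mem (ξ i) (shufFI c w i) := fun i => mem_shufFI (hξb i)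
  have hLm : FI.mem lam (FI.ofScaled (scaleL cU)) := FI.mem_ofScaled _
  obtain ⟨hUG, hUC, hUT⟩ : (∀ i j, FI.mem ⟪U (hexFrame i), U (hexFrame j)⟫ (extU c w (Sum.inl (i, j)))) ∧
      (∀ i, FI.mem ⟪U (hexFrame i), U (hcpShift + ξ)⟫ (extU c w (Sum.inr (Sum.inl i)))) ∧
      FI.mem (‖U (hcpShift + ξ)‖ ^ 2) (extU c w (Sum.inr (Sum.inr 0))) := mem_extFI U ξ hE hX
  -- per label: ‖nbrU k‖² (Gram form, for `d`) and the sharp data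
  have hnbr : ∀ k, FI.mem (‖nbrU U ξ k‖ ^ 2) (nbrSq c w k) := fun k => by
    have := mem_qform13 U (hcpShift + ξ) hUG hUC hUT (hlab k) (hshift k)
    unfold nbrU nbrSq; exact this
  set R : Fin 12 → E3 := fun k => rReal V ξ lam k with hRdef
  have hdk : ∀ k, nbrU U ξ k = lam • nbr k + R k := fun k => nbrU_eq_smul_add_rReal hV ξ k
  have hRm : ∀ k a, FI.mem ((R k) a) (rVec (devH c w (scaleL cU)) (shufFI c w) (FI.ofScaled (scaleL cU)) k a) := fun k a =>
    mem_rVec V ξ hE' hX hLm k a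
  have hP : ∀ k, FI.mem ⟪R k, nbr k⟫ (rP (devH c w (scaleL cU)) (shufFI c w) (FI.ofScaled (scaleL cU)) k) := fun k =>
    mem_dot3 (hRm k) (mem_nbrFI k)
  have hQ : ∀ k, FI.mem (‖R k‖ ^ 2) (rSq (devH c w (scaleL cU)) (shufFI c w) (FI.ofScaled (scaleL cU)) k) := fun k => by
    rw [← real_inner_self_eq_norm_sq]; exact mem_dot3 (hRm k) (hRm k)
  have hN : ∀ k, FI.mem (‖nbrU U ξ k‖ ^ 2) (nrm2 (devH c w (scaleL cU)) (shufFI c w) (FI.ofScaled (scaleL cU)) k) := fun k => by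
    have e : ‖nbrU U ξ k‖ ^ 2 = (lam ^ 2 + lam * ⟪R k, nbr k⟫ * ((2 : ℤ) : ℝ)) + ‖R k‖ ^ 2 := by
      rw [hdk, norm_add_sq_real, norm_smul, Real.norm_eq_abs, abs_of_nonneg hlam0, norm_nbr, mul_one, real_inner_smul_left,
        real_inner_comm]
      push_cast; ring
    rw [e]
    exact FI.mem_add (FI.mem_add (FI.mem_sqr hLm) (FI.mem_mulInt (FI.mem_mul hLm (hP k)) 2)) (hQ k)
  have hD : ∀ k, FI.mem (‖nbrU U ξ k‖ - lam) (dlt (devH c w (scaleL cU)) (shufFI c w) (FI.ofScaled (scaleL cU)) k) := fun k => by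
    have := FI.mem_sqrt (hN k)
    rw [Real.sqrt_sq (norm_nonneg _)] at this
    exact FI.mem_sub this hLm
  have hMis : ∀ k k', FI.mem (‖nbrU U ξ k - ‖nbrU U ξ k'‖ • nbr k‖ ^ 2)
      (mis (devH c w (scaleL cU)) (shufFI c w) (FI.ofScaled (scaleL cU)) k k') := fun k k' => by
    have hsplit : nbrU U ξ k - ‖nbrU U ξ k'‖ • nbr k = R k - (‖nbrU U ξ k'‖ - lam) • nbr k := by
      rw [hdk, sub_smul]; abel
    have e : ‖nbrU U ξ k - ‖nbrU U ξ k'‖ • nbr k‖ ^ 2 =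
        (‖R k‖ ^ 2 - (‖nbrU U ξ k'‖ - lam) * ⟪R k, nbr k⟫ * ((2 : ℤ) : ℝ)) + (‖nbrU U ξ k'‖ - lam) ^ 2 := by
      rw [hsplit, norm_sub_sq_real, norm_smul, Real.norm_eq_abs, norm_nbr, mul_one, sq_abs, real_inner_smul_right]
      push_cast; ring
    rw [e]
    exact FI.mem_add (FI.mem_sub (hQ k) (FI.mem_mulInt (FI.mem_mul (hD k') (hP k)) 2)) (FI.mem_sqr (hD k'))
  -- `‖ξ‖ ≤ 1/2`
  have hxi : FI.mem (‖ξ‖ ^ 2) (xiSq c w) := by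
    rw [EuclideanSpace.norm_sq_eq, Fin.sum_univ_three]
    simp only [Real.norm_eq_abs, sq_abs]
    exact FI.mem_add (FI.mem_add (FI.mem_sqr (hX 0)) (FI.mem_sqr (hX 1))) (FI.mem_sqr (hX 2))
  have hξ2 : ‖ξ‖ ≤ 1 / 2 := by
    have h1 := (FI.mem_def.1 hxi).2
    have h2 : (4 : ℝ) * (xiSq c w).hi ≤ SC := by exact_mod_cast hxi4
    have h3 : ‖ξ‖ ^ 2 * SC * 4 ≤ SC * 1 := by linarith
    have hsq : ‖ξ‖ ^ 2 ≤ (1 / 2) ^ 2 := by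
      have := le_of_mul_le_mul_right (by linarith : ‖ξ‖ ^ 2 * 4 * SC ≤ 1 * SC) hS
      linarith
    exact (abs_le_of_sq_le_sq' hsq (by norm_num)).2
  -- the minimum and its enclosures
  obtain ⟨k₀, -, hk₀⟩ := Finset.exists_min_image Finset.univ (fun k : Fin 12 => ‖nbrU U ξ k‖) Finset.univ_nonempty
  have hd_le : ∀ k, ‖nbrU U ξ k₀‖ ≤ ‖nbrU U ξ k‖ := fun k => hk₀ k (Finset.mem_univ k)
  have hd0 : 0 ≤ ‖nbrU U ξ k₀‖ := norm_nonneg _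
  have hDsq_lo : ∀ k, ((dSqH c w).lo : ℝ) ≤ ‖nbrU U ξ k‖ ^ 2 * SC := fun k => by
    have h1 : lmin (K12H.map fun k => (nbrSq c w k).lo) ≤ (nbrSq c w k).lo := lmin_le_of_mem _ _ (List.mem_map.2 ⟨k, mem_K12H k, rfl⟩)
    have h1' : ((lmin (K12H.map fun k => (nbrSq c w k).lo) : ℤ) : ℝ) ≤ (nbrSq c w k).lo := by exact_mod_cast h1
    exact h1'.trans (FI.mem_def.1 (hnbr k)).1
  have hmemDsq : FI.mem (‖nbrU U ξ k₀‖ ^ 2) (dSqH c w) := by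
    refine ⟨hDsq_lo k₀, ?_⟩
    have hl : (K12H.map fun k => (nbrSq c w k).hi) ≠ [] := by simp [K12H]
    obtain ⟨k', _, he⟩ := List.mem_map.1 (lmin_mem _ hl)
    have h2 := (FI.mem_def.1 (hnbr k')).2
    have hle := mul_le_mul_of_nonneg_right (pow_le_pow_left₀ hd0 (hd_le k') 2) hS.le
    show ‖nbrU U ξ k₀‖ ^ 2 * SC ≤ (((dSqH c w).hi : ℤ) : ℝ)
    rw [show (dSqH c w).hi = lmin (K12H.map fun k => (nbrSq c w k).hi) from rfl, ← he]
    linarith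
  have hmemD : FI.mem ‖nbrU U ξ k₀‖ (dEnclH c w) := by
    have := FI.mem_sqrt hmemDsq
    rwa [Real.sqrt_sq hd0] at this
  obtain ⟨hDlo, hDhi⟩ := FI.mem_def.1 hmemD
  have h0' : (0 : ℝ) < (dEnclH c w).lo := by exact_mod_cast h0
  -- the sharp `d²` lower end
  have hd2S : ∀ k, ((d2S c w (scaleL cU) : ℤ) : ℝ) ≤ ‖nbrU U ξ k‖ ^ 2 * SC := fun k => by
    have h1 : d2S c w (scaleL cU) ≤ (nrm2 (devH c w (scaleL cU)) (shufFI c w) (FI.ofScaled (scaleL cU)) k).lo :=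
      lmin_le_of_mem _ _ (List.mem_map.2 ⟨k, mem_K12H k, rfl⟩)
    have h1' : ((d2S c w (scaleL cU) : ℤ) : ℝ) ≤ (nrm2 (devH c w (scaleL cU)) (shufFI c w) (FI.ofScaled (scaleL cU)) k).lo := by
      exact_mod_cast h1
    exact h1'.trans (FI.mem_def.1 (hN k)).1
  refine ⟨hξ2, Riso, ((d2S c w (scaleL cU) : ℤ) : ℝ) / SC, by norm_num, by norm_num, div_pos h0' hS, ?_, ?_, ?_, ?_, ?_, ?_, ?_, ?_⟩
  · -- dhi ≤ 3/2
    rw [div_le_iff₀ hS]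
    have : (2 : ℝ) * (dEnclH c w).hi ≤ 3 * SC := by exact_mod_cast h32
    linarith
  · -- (d) lower
    intro k
    have := mul_le_mul_of_nonneg_right (hd_le k) hS.le
    rw [div_le_iff₀ hS]
    linarith
  · -- (d) upper
    exact ⟨k₀, by rw [le_div_iff₀ hS]; exact hDhi⟩
  · -- d2lo
    intro k
    rw [div_le_iff₀ hS]
    exact hd2S k
  · -- (F1) the CENTRED ROTATED pair bound, for minimising scales `k'` only
    intro k k' hk'
    have hposs : possMinH c w k' = true := by
      unfold possMinH
      rw [decide_eq_true_eq]
      have hl : (K12H.map fun k => (nbrSq c w k).hi) ≠ [] := by simp [K12H]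
      obtain ⟨j', _, he⟩ := List.mem_map.1 (lmin_mem _ hl)
      have h1 := (FI.mem_def.1 (hnbr k')).1
      have h2 := (FI.mem_def.1 (hnbr j')).2
      have hle := mul_le_mul_of_nonneg_right (pow_le_pow_left₀ (norm_nonneg _) (hk' j') 2) hS.le
      have key : (((nbrSq c w k').lo : ℤ) : ℝ) ≤ ((lmin (K12H.map fun k => (nbrSq c w k).hi) : ℤ) : ℝ) := by
        rw [← he]
        linarith
      have key' : (nbrSq c w k').lo ≤ lmin (K12H.map fun k => (nbrSq c w k).hi) := by exact_mod_cast key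
      exact key'
    have hp := hpair k (mem_K12H k) k' (mem_K12H k')
    rw [hposs] at hp
    exact norm_pair_le_of_cPairOKRS hsymm U ξ hsa hbox hξb k k' q Riso hRiso hNq (by simpa using hp)
  · -- (F2) clean gap
    intro k
    have f3 := hK k (mem_K12H k)
    have hC := (FI.mem_def.1 (hnbr k)).2
    have f3' : ((nbrSq c w k).hi : ℝ) * SC * 10000 ≤ (130 * (dEnclH c w).lo - SC) ^ 2 := by exact_mod_cast f3
    have h130' : (SC : ℝ) ≤ 130 * (dEnclH c w).lo := by exact_mod_cast h130
    have hC' := mul_le_mul_of_nonneg_right hC (by positivity : (0 : ℝ) ≤ SC * 10000)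
    have hsq : (‖nbrU U ξ k‖ * (100 * SC)) ^ 2 ≤ ((130 : ℝ) * (dEnclH c w).lo - SC) ^ 2 := by
      have e : (‖nbrU U ξ k‖ * (100 * SC)) ^ 2 = ‖nbrU U ξ k‖ ^ 2 * SC * (SC * 10000) := by ring
      rw [e]; linarith
    have hle := (abs_le_of_sq_le_sq' hsq (by linarith)).2
    rw [show (13 : ℝ) / 10 * (((dEnclH c w).lo : ℝ) / SC) - 1 / 100 = (130 * ((dEnclH c w).lo : ℝ) - SC) / (100 * SC) by field_simp; ring,
      le_div_iff₀ (by positivity)]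
    exact hle
  · -- (F3) far, family A
    intro b hb hb0 hnot
    rw [← box7all_eq] at hb
    obtain ⟨hA, _⟩ := hfar b hb
    rcases hA with rfl | ⟨k, hk, he⟩ | f4
    · exact (hb0 rfl).elim
    · exact (hnot k hk he).elim
    · have f4' : ((130 : ℝ) * (dEnclH c w).hi + SC) ^ 2 ≤ ((qform13 (extU c w) b false).lo : ℝ) * SC * 10000 := by exact_mod_cast f4
      have hm := mem_qform13 U (hcpShift + ξ) hUG hUC hUT b false
      simp only [Bool.false_eq_true, ↓reduceIte, add_zero] at hm
      have hC := (FI.mem_def.1 hm).1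
      have hC' := mul_le_mul_of_nonneg_right hC (by positivity : (0 : ℝ) ≤ SC * 10000)
      have hsq : ((130 : ℝ) * (dEnclH c w).hi + SC) ^ 2 ≤ (‖latPt U hexFrame b‖ * (100 * SC)) ^ 2 := by
        have e : (‖latPt U hexFrame b‖ * (100 * SC)) ^ 2 = ‖latPt U hexFrame b‖ ^ 2 * SC * (SC * 10000) := by ring
        rw [e]; linarith
      have hle := (abs_le_of_sq_le_sq' hsq (by positivity)).2
      rw [show (13 : ℝ) / 10 * (((dEnclH c w).hi : ℝ) / SC) + 1 / 100 = (130 * ((dEnclH c w).hi : ℝ) + SC) / (100 * SC) by field_simp; ring,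
        div_le_iff₀ (by positivity)]
      exact hle
  · -- (F3) far, family B
    intro b hb hnot
    rw [← box7all_eq] at hb
    obtain ⟨_, hB⟩ := hfar b hb
    rcases hB with ⟨k, hk, he⟩ | f4
    · exact (hnot k hk he).elim
    · have f4' : ((130 : ℝ) * (dEnclH c w).hi + SC) ^ 2 ≤ ((qform13 (extU c w) b true).lo : ℝ) * SC * 10000 := by exact_mod_cast f4
      have hm := mem_qform13 U (hcpShift + ξ) hUG hUC hUT b true
      simp only [↓reduceIte] at hm
      have hC := (FI.mem_def.1 hm).1
      have hC' := mul_le_mul_of_nonneg_right hC (by positivity : (0 : ℝ) ≤ SC * 10000)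
      have hsq : ((130 : ℝ) * (dEnclH c w).hi + SC) ^ 2 ≤ (‖latPt U hexFrame b + U (hcpShift + ξ)‖ * (100 * SC)) ^ 2 := by
        have e : (‖latPt U hexFrame b + U (hcpShift + ξ)‖ * (100 * SC)) ^ 2 = ‖latPt U hexFrame b + U (hcpShift + ξ)‖ ^ 2 * SC * (SC * 10000) := by
          ring
        rw [e]; linarith
      have hle := (abs_le_of_sq_le_sq' hsq (by positivity)).2
      rw [show (13 : ℝ) / 10 * (((dEnclH c w).hi : ℝ) / SC) + 1 / 100 = (130 * ((dEnclH c w).hi : ℝ) + SC) / (100 * SC) by field_simp; ring,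
        div_le_iff₀ (by positivity)]
      exact hle



end Summit.AtomisticToContinuum.Crystallization.Theorems.FrustratedLawDichotomyStrainedPatchHomEntryFitHcpCentred

end
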